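import Literature.Analysis.FluidPDE.CLStressPointwise
import Literature.Analysis.FluidPDE.NSRPerturbation
import Literature.Analysis.FluidPDE.AntidivergenceL2
import HarnessLib

/-!
# Cheskidov–Luo convex integration: the `L¹_t L^r_x` estimate of the new Reynolds stress (CL22 §5.3)

Analysis/FluidPDE support file (all results proved) for the proof of Prop. 4.1 of A. Cheskidov,
X. Luo, *Sharp nonuniqueness for the Navier–Stokes equations*, Invent. Math. 229 (2022) =
arXiv:2009.06596, §5.3 (numbering of the held arXiv copy): Lemmas 5.6 (linear error), 5.7
(correction error), 5.8 (oscillation error) — "for all sufficiently large `λ`, each part of the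
stress `R₁` is less than `δ/4`". Here, for the new stress
`R₁ = S̊₁ + (u ⊗ w + w ⊗ u)˚ - (∇w + ∇wᵀ) + ℛ ff` of `Torus.IsNSReynoldsOn.perturb`
(`NSRPerturbation`) built on the perturbation `D.w` and the fields `D.S₁`, `D.ff` of
`CLPerturbation` / `CLStressAlgebra` (data `D : CL22.Datum d`), we prove the QUANTITATIVE form

  `‖R₁‖_{L¹(0,T;L^r(𝕋^d))} ≤ K · 𝔰`,   `𝔰 = ν⁻¹ + κ^{-1/2}σμ^{a+1-(d-1)/r} + κ^{-1/2}μ^a`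
                                        `+ νκ^{1/2}σ⁻¹μ^{a-1-(d-1)/r} + νκ^{1/2}σ⁻²μ⁻² + σ⁻¹μ^{2a}`

(`eLqLpNorm_one_perturbedStress_le`; `a = (d-1)/2`, `1 ≤ r ≤ 2`), where `K = stressConst …` is
an explicit polynomial in the parameter-free bounds `A` (`D.DataBounds A`, "`C_u`"), the block
constant `C` (`D.BlockConsts C`), `U = sup‖u‖`, `T`, `d`, `#Λ` and the `L²` bound of `ℛ`
(`Torus.antidivergenceL2Const`, CL22 Thm. 7.3 for `p = 2`, `AntidivergenceL2`) — in particular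
INDEPENDENT of `ν, κ, μ, σ`. The six monomials of `𝔰` (`Datum.small`) are exactly the products
bounded by `λ^{-γ}` in CL22 Lemma 5.1 ((5.2): `νκ^{1/2}σ⁻¹μ⁻¹μ^{(d-1)/2-(d-1)/r} ≤ λ^{-γ}`;
(5.4) with `q = r`: `κ^{-1/2}σμμ^{(d-1)/2-(d-1)/q} ≤ λ^{-γ}`) plus `ν⁻¹`, `σ⁻¹μ^{d-1}`,
`κ^{-1/2}μ^{(d-1)/2}`, `νκ^{1/2}σ⁻²μ⁻²`, all `≤ λ^{-γ}` under the parameter choice of §5.1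
(proved in the assembly file).

Route (pointwise `‖R₁‖ ≤ 2‖S₁‖ + 4‖u‖‖w‖ + 2∑ᵢ‖∂ᵢw‖ + ‖ℛff‖`, `NSRPerturbation`): slice bounds of
`CLVelocityEstimates` / `CLStressPointwise` for every piece (`ℛ` through `L²`, `L^r ≤ L²` on the
torus), each of the shape `∑_x (P₁|G_x| + P₂|G_x'| + P₃G_x²) + P₄`, then the time factors
`∫₀ᵀ|G_x| ≤ (T+1)κ^{-1/2}A`, `∫₀ᵀ|G_x'| ≤ (T+1)νκ^{1/2}A`, `∫₀ᵀG_x² ≤ T+1` (`CLDataBounds`), and the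
domination of every resulting monomial in the parameters by one of the six of `𝔰`
(`ν, κ, μ, σ ≥ 1`).

## References

* A. Cheskidov, X. Luo, arXiv:2009.06596, §5.1 Lemma 5.1, §5.3 Lemmas 5.6–5.8, §7.2 Thm. 7.3.
  [`CheskidovLuo2022`]
-/

noncomputable section

open Set Filter Topology Function MeasureTheory Finset
open scoped ContDiff ENNReal

namespace Literature.Analysis.FluidPDE

namespace CL22

open FunctionSpaces NashGeometric Mikado Intermittent

variable {d : Type*} [Fintype d] [DecidableEq d]

namespace Datum

variable (D : Datum d)

/-! ## The small parameter combinations -/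

/-- **The six small monomials** `𝔰 = ν⁻¹ + κ^{-1/2}σμ^{a+1-(d-1)/r} + κ^{-1/2}μ^a +
νκ^{1/2}σ⁻¹μ^{a-1-(d-1)/r} + νκ^{1/2}σ⁻²μ⁻² + σ⁻¹μ^{2a}` controlling the new stress
(CL22 Lemma 5.1 (5.2), (5.4) and the sizes `ν⁻¹`, `σ⁻¹μ^{…}` of Lemmas 5.6–5.8). [cite: CheskidovLuo2022, §5.1 Lemma 5.1] -/
def small (r : ℝ) : ℝ :=
  D.ν⁻¹ + D.κ ^ (-(1 / 2 : ℝ)) * D.σ * D.μ ^ (aexp d + 1 - ((Fintype.card d : ℝ) - 1) / r) +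
    D.κ ^ (-(1 / 2 : ℝ)) * D.μ ^ aexp d +
    D.ν * D.κ ^ (1 / 2 : ℝ) * (D.σ : ℝ)⁻¹ * D.μ ^ (aexp d - 1 - ((Fintype.card d : ℝ) - 1) / r) +
    D.ν * D.κ ^ (1 / 2 : ℝ) * ((D.σ : ℝ) ^ 2)⁻¹ * D.μ ^ (-2 : ℝ) + (D.σ : ℝ)⁻¹ * D.μ ^ (2 * aexp d)

/-- **The explicit constant of the stress estimate** (a polynomial in `A`, `C`, `U`, `T`, the `L²`
bound `Cℛ` of `ℛ`, `d` and `N = #Λ`; every parameter power of the slice bounds replaced by `1`).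
[folklore] -/
def stressConst (A C U Cℛ T : ℝ) (dd N : ℝ) : ℝ :=
  N * ((2 * ((2 * (3 * A * C) + 2 * (6 * A * (dd * C))) * (N * A)) + 4 * U * (3 * A * C + 6 * A * (dd * C)) +
          2 * dd * (6 * A * C + 12 * A * dd * C) + Cℛ * (3 * A * C + 6 * A * (dd * C))) * ((T + 1) * A) +
        (2 * (6 * A * (dd * C) + 4 * A * dd * (dd * C)) + Cℛ * ((2 * dd + 1) * (2 * A) * dd * (dd * C))) * ((T + 1) * A) +
        (2 * (2 * (3 * A * C) * (6 * A * (dd * C)) + (6 * A * (dd * C)) ^ 2) + 2 * (6 * A * (dd * C)) +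
          Cℛ * ((2 * dd + 1) * (3 * A) * (dd * C))) * (T + 1)) +
    (2 * (N * A) ^ 2 + 4 * U * (N * A) + 2 * dd * (N * A) + Cℛ * (N * (A + 2 * A ^ 2))) * T

variable {D}

/-- The stress constant is nonnegative for nonnegative arguments. [folklore] -/
theorem stressConst_nonneg {A C U Cℛ T dd N : ℝ} (hA : 0 ≤ A) (hC : 0 ≤ C) (hU : 0 ≤ U) (hCℛ : 0 ≤ Cℛ)
    (hT : 0 ≤ T) (hdd : 0 ≤ dd) (hN : 0 ≤ N) : 0 ≤ stressConst A C U Cℛ T dd N := by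
  unfold stressConst; positivity

section Small

variable (h : D.Valid) {r : ℝ} (hr : 1 ≤ r) (hr2 : r ≤ 2)
include h

omit [DecidableEq d] in
/-- `0 ≤ (d-1)/r`. [folklore] -/
theorem er_nonneg (hr : 1 ≤ r) : 0 ≤ ((Fintype.card d : ℝ) - 1) / r := by
  have h1 : (1 : ℝ) ≤ Fintype.card d := by have := h.hd; exact_mod_cast (by omega : 1 ≤ Fintype.card d)
  exact div_nonneg (by linarith) (by linarith)

omit [DecidableEq d] in
/-- `0 ≤ a`. [folklore] -/
theorem aexp_nonneg : 0 ≤ aexp d := by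
  have h1 : (1 : ℝ) ≤ Fintype.card d := by have := h.hd; exact_mod_cast (by omega : 1 ≤ Fintype.card d)
  rw [aexp]; linarith

omit [DecidableEq d] in
/-- All six monomials are nonnegative; the individual ones are dominated by `𝔰`. [folklore] -/
theorem small_terms_nonneg :
    0 ≤ D.ν⁻¹ ∧ 0 ≤ D.κ ^ (-(1 / 2 : ℝ)) * D.σ * D.μ ^ (aexp d + 1 - ((Fintype.card d : ℝ) - 1) / r) ∧
      0 ≤ D.κ ^ (-(1 / 2 : ℝ)) * D.μ ^ aexp d ∧
      0 ≤ D.ν * D.κ ^ (1 / 2 : ℝ) * (D.σ : ℝ)⁻¹ * D.μ ^ (aexp d - 1 - ((Fintype.card d : ℝ) - 1) / r) ∧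
      0 ≤ D.ν * D.κ ^ (1 / 2 : ℝ) * ((D.σ : ℝ) ^ 2)⁻¹ * D.μ ^ (-2 : ℝ) ∧ 0 ≤ (D.σ : ℝ)⁻¹ * D.μ ^ (2 * aexp d) := by
  have hν : 0 ≤ D.ν := by linarith [h.hν]
  have hκ : 0 ≤ D.κ := by linarith [h.hκ]
  have hμ : 0 ≤ D.μ := by linarith [h.hμ]
  refine ⟨inv_nonneg.2 hν, by positivity, by positivity, by positivity, by positivity, by positivity⟩

omit [DecidableEq d] in
/-- `ν⁻¹ ≤ 𝔰`. [folklore] -/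
theorem S1_le_small : D.ν⁻¹ ≤ D.small r := by
  obtain ⟨h1, h2, h3, h4, h5, h6⟩ := small_terms_nonneg h (r := r); unfold small; linarith

omit [DecidableEq d] in
/-- `κ^{-1/2}σμ^{a+1-(d-1)/r} ≤ 𝔰`. [folklore] -/
theorem S2_le_small : D.κ ^ (-(1 / 2 : ℝ)) * D.σ * D.μ ^ (aexp d + 1 - ((Fintype.card d : ℝ) - 1) / r) ≤ D.small r := by
  obtain ⟨h1, h2, h3, h4, h5, h6⟩ := small_terms_nonneg h (r := r); unfold small; linarith

omit [DecidableEq d] in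
/-- `κ^{-1/2}μ^a ≤ 𝔰`. [folklore] -/
theorem S2'_le_small : D.κ ^ (-(1 / 2 : ℝ)) * D.μ ^ aexp d ≤ D.small r := by
  obtain ⟨h1, h2, h3, h4, h5, h6⟩ := small_terms_nonneg h (r := r); unfold small; linarith

omit [DecidableEq d] in
/-- `νκ^{1/2}σ⁻¹μ^{a-1-(d-1)/r} ≤ 𝔰`. [folklore] -/
theorem S3_le_small : D.ν * D.κ ^ (1 / 2 : ℝ) * (D.σ : ℝ)⁻¹ * D.μ ^ (aexp d - 1 - ((Fintype.card d : ℝ) - 1) / r) ≤ D.small r := by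
  obtain ⟨h1, h2, h3, h4, h5, h6⟩ := small_terms_nonneg h (r := r); unfold small; linarith

omit [DecidableEq d] in
/-- `νκ^{1/2}σ⁻²μ⁻² ≤ 𝔰`. [folklore] -/
theorem S4_le_small : D.ν * D.κ ^ (1 / 2 : ℝ) * ((D.σ : ℝ) ^ 2)⁻¹ * D.μ ^ (-2 : ℝ) ≤ D.small r := by
  obtain ⟨h1, h2, h3, h4, h5, h6⟩ := small_terms_nonneg h (r := r); unfold small; linarith

omit [DecidableEq d] in
/-- `σ⁻¹μ^{2a} ≤ 𝔰`. [folklore] -/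
theorem S5_le_small : (D.σ : ℝ)⁻¹ * D.μ ^ (2 * aexp d) ≤ D.small r := by
  obtain ⟨h1, h2, h3, h4, h5, h6⟩ := small_terms_nonneg h (r := r); unfold small; linarith

omit [DecidableEq d] in
/-- `0 ≤ 𝔰`. [folklore] -/
theorem small_nonneg : 0 ≤ D.small r := (inv_nonneg.2 (by linarith [h.hν])).trans (S1_le_small h)

/-! ### Domination of the monomials that actually occur -/

omit [DecidableEq d] in
/-- `μ^{a-(d-1)/r} κ^{-1/2} ≤ κ^{-1/2} μ^a ≤ 𝔰`. [folklore] -/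
theorem dom_wp (hr : 1 ≤ r) : D.μ ^ (aexp d - ((Fintype.card d : ℝ) - 1) / r) * D.κ ^ (-(1 / 2 : ℝ)) ≤ D.small r := by
  have hκ0 : 0 ≤ D.κ ^ (-(1 / 2 : ℝ)) := Real.rpow_nonneg (by linarith [h.hκ]) _
  have h1 : D.μ ^ (aexp d - ((Fintype.card d : ℝ) - 1) / r) ≤ D.μ ^ aexp d :=
    Real.rpow_le_rpow_of_exponent_le h.hμ (by linarith [er_nonneg h hr])
  calc D.μ ^ (aexp d - ((Fintype.card d : ℝ) - 1) / r) * D.κ ^ (-(1 / 2 : ℝ)) ≤ D.μ ^ aexp d * D.κ ^ (-(1 / 2 : ℝ)) :=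
        mul_le_mul_of_nonneg_right h1 hκ0
    _ = D.κ ^ (-(1 / 2 : ℝ)) * D.μ ^ aexp d := mul_comm _ _
    _ ≤ D.small r := S2'_le_small h

omit [DecidableEq d] in
/-- `σ⁻¹μ^{a-1-(d-1)/r} κ^{-1/2} ≤ 𝔰`. [folklore] -/
theorem dom_wc (hr : 1 ≤ r) :
    (D.σ : ℝ)⁻¹ * D.μ ^ (aexp d - 1 - ((Fintype.card d : ℝ) - 1) / r) * D.κ ^ (-(1 / 2 : ℝ)) ≤ D.small r := by
  have hκ0 : 0 ≤ D.κ ^ (-(1 / 2 : ℝ)) := Real.rpow_nonneg (by linarith [h.hκ]) _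
  have hσ1 : (1 : ℝ) ≤ D.σ := by exact_mod_cast h.hσ
  have hσ : (D.σ : ℝ)⁻¹ ≤ 1 := inv_le_one_of_one_le₀ hσ1
  have h1 : D.μ ^ (aexp d - 1 - ((Fintype.card d : ℝ) - 1) / r) ≤ D.μ ^ aexp d :=
    Real.rpow_le_rpow_of_exponent_le h.hμ (by linarith [er_nonneg h hr])
  have hμ0 : 0 ≤ D.μ ^ aexp d := Real.rpow_nonneg (by linarith [h.hμ]) _
  calc (D.σ : ℝ)⁻¹ * D.μ ^ (aexp d - 1 - ((Fintype.card d : ℝ) - 1) / r) * D.κ ^ (-(1 / 2 : ℝ))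
      ≤ 1 * D.μ ^ aexp d * D.κ ^ (-(1 / 2 : ℝ)) :=
        mul_le_mul_of_nonneg_right (mul_le_mul hσ h1 (Real.rpow_nonneg (by linarith [h.hμ]) _) zero_le_one) hκ0
    _ = D.κ ^ (-(1 / 2 : ℝ)) * D.μ ^ aexp d := by ring
    _ ≤ D.small r := S2'_le_small h

omit [DecidableEq d] in
/-- `σμ^{a+1-(d-1)/r} κ^{-1/2} ≤ 𝔰`. [folklore] -/
theorem dom_dwp : D.σ * D.μ ^ (aexp d + 1 - ((Fintype.card d : ℝ) - 1) / r) * D.κ ^ (-(1 / 2 : ℝ)) ≤ D.small r := by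
  calc D.σ * D.μ ^ (aexp d + 1 - ((Fintype.card d : ℝ) - 1) / r) * D.κ ^ (-(1 / 2 : ℝ))
      = D.κ ^ (-(1 / 2 : ℝ)) * D.σ * D.μ ^ (aexp d + 1 - ((Fintype.card d : ℝ) - 1) / r) := by ring
    _ ≤ D.small r := S2_le_small h

omit [DecidableEq d] in
/-- `μ^a ν⁻¹ κ^{-1/2} ≤ 𝔰`. [folklore] -/
theorem dom_cross : D.μ ^ aexp d * D.ν⁻¹ * D.κ ^ (-(1 / 2 : ℝ)) ≤ D.small r := by
  have hκ0 : 0 ≤ D.κ ^ (-(1 / 2 : ℝ)) := Real.rpow_nonneg (by linarith [h.hκ]) _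
  have hν : D.ν⁻¹ ≤ 1 := inv_le_one_of_one_le₀ h.hν
  have hμ0 : 0 ≤ D.μ ^ aexp d := Real.rpow_nonneg (by linarith [h.hμ]) _
  calc D.μ ^ aexp d * D.ν⁻¹ * D.κ ^ (-(1 / 2 : ℝ)) ≤ D.μ ^ aexp d * 1 * D.κ ^ (-(1 / 2 : ℝ)) := by
        gcongr
    _ = D.κ ^ (-(1 / 2 : ℝ)) * D.μ ^ aexp d := by ring
    _ ≤ D.small r := S2'_le_small h

omit [DecidableEq d] in
/-- `σ⁻¹μ^{a-1} ν⁻¹ κ^{-1/2} ≤ 𝔰`. [folklore] -/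
theorem dom_cross' : (D.σ : ℝ)⁻¹ * D.μ ^ (aexp d - 1) * D.ν⁻¹ * D.κ ^ (-(1 / 2 : ℝ)) ≤ D.small r := by
  have hκ0 : 0 ≤ D.κ ^ (-(1 / 2 : ℝ)) := Real.rpow_nonneg (by linarith [h.hκ]) _
  have hν : D.ν⁻¹ ≤ 1 := inv_le_one_of_one_le₀ h.hν
  have hσ1 : (1 : ℝ) ≤ D.σ := by exact_mod_cast h.hσ
  have hσ : (D.σ : ℝ)⁻¹ ≤ 1 := inv_le_one_of_one_le₀ hσ1
  have h1 : D.μ ^ (aexp d - 1) ≤ D.μ ^ aexp d := Real.rpow_le_rpow_of_exponent_le h.hμ (by linarith)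
  have hμ0 : 0 ≤ D.μ ^ aexp d := Real.rpow_nonneg (by linarith [h.hμ]) _
  calc (D.σ : ℝ)⁻¹ * D.μ ^ (aexp d - 1) * D.ν⁻¹ * D.κ ^ (-(1 / 2 : ℝ)) ≤ 1 * D.μ ^ aexp d * 1 * D.κ ^ (-(1 / 2 : ℝ)) := by
        refine mul_le_mul_of_nonneg_right ?_ hκ0
        exact mul_le_mul (mul_le_mul hσ h1 (Real.rpow_nonneg (by linarith [h.hμ]) _) zero_le_one) hν
          (inv_nonneg.2 (by linarith [h.hν])) (by positivity)
    _ = D.κ ^ (-(1 / 2 : ℝ)) * D.μ ^ aexp d := by ring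
    _ ≤ D.small r := S2'_le_small h

omit [DecidableEq d] in
/-- `κ^{-1/2} ≤ 𝔰`. [folklore] -/
theorem dom_F1 : D.κ ^ (-(1 / 2 : ℝ)) ≤ D.small r := by
  have hκ0 : 0 ≤ D.κ ^ (-(1 / 2 : ℝ)) := Real.rpow_nonneg (by linarith [h.hκ]) _
  have h1 : (1 : ℝ) ≤ D.μ ^ aexp d := Real.one_le_rpow h.hμ (aexp_nonneg h)
  calc D.κ ^ (-(1 / 2 : ℝ)) = D.κ ^ (-(1 / 2 : ℝ)) * 1 := (mul_one _).symm
    _ ≤ D.κ ^ (-(1 / 2 : ℝ)) * D.μ ^ aexp d := mul_le_mul_of_nonneg_left h1 hκ0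
    _ ≤ D.small r := S2'_le_small h

omit [DecidableEq d] in
/-- `σ⁻¹μ⁻¹ κ^{-1/2} ≤ 𝔰`. [folklore] -/
theorem dom_F2 : (D.σ : ℝ)⁻¹ * D.μ ^ (-1 : ℝ) * D.κ ^ (-(1 / 2 : ℝ)) ≤ D.small r := by
  have hκ0 : 0 ≤ D.κ ^ (-(1 / 2 : ℝ)) := Real.rpow_nonneg (by linarith [h.hκ]) _
  have hσ1 : (1 : ℝ) ≤ D.σ := by exact_mod_cast h.hσ
  have hσ : (D.σ : ℝ)⁻¹ ≤ 1 := inv_le_one_of_one_le₀ hσ1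
  have h1 : D.μ ^ (-1 : ℝ) ≤ 1 := Real.rpow_le_one_of_one_le_of_nonpos h.hμ (by norm_num)
  calc (D.σ : ℝ)⁻¹ * D.μ ^ (-1 : ℝ) * D.κ ^ (-(1 / 2 : ℝ)) ≤ 1 * 1 * D.κ ^ (-(1 / 2 : ℝ)) := by
        refine mul_le_mul_of_nonneg_right (mul_le_mul hσ h1 (Real.rpow_nonneg (by linarith [h.hμ]) _) zero_le_one) hκ0
    _ = D.κ ^ (-(1 / 2 : ℝ)) := by ring
    _ ≤ D.small r := dom_F1 h

omit [DecidableEq d] in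
/-- `σ⁻¹μ^{a-1-(d-1)/r} νκ^{1/2} ≤ 𝔰`. [folklore] -/
theorem dom_EA : (D.σ : ℝ)⁻¹ * D.μ ^ (aexp d - 1 - ((Fintype.card d : ℝ) - 1) / r) * (D.ν * D.κ ^ (1 / 2 : ℝ)) ≤ D.small r := by
  calc (D.σ : ℝ)⁻¹ * D.μ ^ (aexp d - 1 - ((Fintype.card d : ℝ) - 1) / r) * (D.ν * D.κ ^ (1 / 2 : ℝ))
      = D.ν * D.κ ^ (1 / 2 : ℝ) * (D.σ : ℝ)⁻¹ * D.μ ^ (aexp d - 1 - ((Fintype.card d : ℝ) - 1) / r) := by ring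
    _ ≤ D.small r := S3_le_small h

omit [DecidableEq d] in
/-- `σ⁻²μ^{a-2-(d-1)/r} νκ^{1/2} ≤ 𝔰`. [folklore] -/
theorem dom_EB : ((D.σ : ℝ) ^ 2)⁻¹ * D.μ ^ (aexp d - 2 - ((Fintype.card d : ℝ) - 1) / r) * (D.ν * D.κ ^ (1 / 2 : ℝ)) ≤ D.small r := by
  have hσ1 : (1 : ℝ) ≤ D.σ := by exact_mod_cast h.hσ
  have hσ0 : (0 : ℝ) < D.σ := by linarith
  have hσ2 : ((D.σ : ℝ) ^ 2)⁻¹ ≤ (D.σ : ℝ)⁻¹ := by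
    rw [inv_le_inv₀ (by positivity) hσ0]; nlinarith
  have h1 : D.μ ^ (aexp d - 2 - ((Fintype.card d : ℝ) - 1) / r) ≤ D.μ ^ (aexp d - 1 - ((Fintype.card d : ℝ) - 1) / r) :=
    Real.rpow_le_rpow_of_exponent_le h.hμ (by linarith)
  have hνκ : 0 ≤ D.ν * D.κ ^ (1 / 2 : ℝ) := mul_nonneg (by linarith [h.hν]) (Real.rpow_nonneg (by linarith [h.hκ]) _)
  calc ((D.σ : ℝ) ^ 2)⁻¹ * D.μ ^ (aexp d - 2 - ((Fintype.card d : ℝ) - 1) / r) * (D.ν * D.κ ^ (1 / 2 : ℝ))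
      ≤ (D.σ : ℝ)⁻¹ * D.μ ^ (aexp d - 1 - ((Fintype.card d : ℝ) - 1) / r) * (D.ν * D.κ ^ (1 / 2 : ℝ)) :=
        mul_le_mul_of_nonneg_right (mul_le_mul hσ2 h1 (Real.rpow_nonneg (by linarith [h.hμ]) _) (by positivity)) hνκ
    _ ≤ D.small r := dom_EA h

omit [DecidableEq d] in
/-- `σ⁻²μ⁻² νκ^{1/2} ≤ 𝔰`. [folklore] -/
theorem dom_F4B : ((D.σ : ℝ) ^ 2)⁻¹ * D.μ ^ (-2 : ℝ) * (D.ν * D.κ ^ (1 / 2 : ℝ)) ≤ D.small r := by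
  calc ((D.σ : ℝ) ^ 2)⁻¹ * D.μ ^ (-2 : ℝ) * (D.ν * D.κ ^ (1 / 2 : ℝ)) = D.ν * D.κ ^ (1 / 2 : ℝ) * ((D.σ : ℝ) ^ 2)⁻¹ * D.μ ^ (-2 : ℝ) := by
        ring
    _ ≤ D.small r := S4_le_small h

omit [DecidableEq d] in
/-- `μ^a σ⁻¹μ^{a-1} ≤ 𝔰`. [folklore] -/
theorem dom_αβ : D.μ ^ aexp d * ((D.σ : ℝ)⁻¹ * D.μ ^ (aexp d - 1)) ≤ D.small r := by
  have hμ := h.hμ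
  have hμ0 : 0 < D.μ := by linarith
  have hσ0 : 0 ≤ (D.σ : ℝ)⁻¹ := by positivity
  have e : D.μ ^ aexp d * D.μ ^ (aexp d - 1) = D.μ ^ (2 * aexp d - 1) := by
    rw [← Real.rpow_add hμ0]; ring_nf
  have h1 : D.μ ^ (2 * aexp d - 1) ≤ D.μ ^ (2 * aexp d) := Real.rpow_le_rpow_of_exponent_le hμ (by linarith)
  calc D.μ ^ aexp d * ((D.σ : ℝ)⁻¹ * D.μ ^ (aexp d - 1)) = (D.σ : ℝ)⁻¹ * (D.μ ^ aexp d * D.μ ^ (aexp d - 1)) := by ring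
    _ = (D.σ : ℝ)⁻¹ * D.μ ^ (2 * aexp d - 1) := by rw [e]
    _ ≤ (D.σ : ℝ)⁻¹ * D.μ ^ (2 * aexp d) := mul_le_mul_of_nonneg_left h1 hσ0
    _ ≤ D.small r := S5_le_small h

omit [DecidableEq d] in
/-- `(σ⁻¹μ^{a-1})² ≤ 𝔰`. [folklore] -/
theorem dom_ββ : ((D.σ : ℝ)⁻¹ * D.μ ^ (aexp d - 1)) ^ 2 ≤ D.small r := by
  have hμ := h.hμ
  have hμ0 : 0 < D.μ := by linarith
  have hσ1 : (1 : ℝ) ≤ D.σ := by exact_mod_cast h.hσ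
  have hσ : (D.σ : ℝ)⁻¹ ≤ 1 := inv_le_one_of_one_le₀ hσ1
  have hσ0 : 0 ≤ (D.σ : ℝ)⁻¹ := by positivity
  have e : D.μ ^ (aexp d - 1) * D.μ ^ (aexp d - 1) = D.μ ^ (2 * aexp d - 2) := by
    rw [← Real.rpow_add hμ0]; ring_nf
  have h1 : D.μ ^ (2 * aexp d - 2) ≤ D.μ ^ (2 * aexp d) := Real.rpow_le_rpow_of_exponent_le hμ (by linarith)
  have hμp : 0 ≤ D.μ ^ (2 * aexp d - 2) := Real.rpow_nonneg hμ0.le _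
  calc ((D.σ : ℝ)⁻¹ * D.μ ^ (aexp d - 1)) ^ 2 = (D.σ : ℝ)⁻¹ * (D.σ : ℝ)⁻¹ * (D.μ ^ (aexp d - 1) * D.μ ^ (aexp d - 1)) := by ring
    _ = (D.σ : ℝ)⁻¹ * (D.σ : ℝ)⁻¹ * D.μ ^ (2 * aexp d - 2) := by rw [e]
    _ ≤ (D.σ : ℝ)⁻¹ * 1 * D.μ ^ (2 * aexp d) :=
        mul_le_mul (mul_le_mul_of_nonneg_left hσ hσ0) h1 hμp (by positivity)
    _ = (D.σ : ℝ)⁻¹ * D.μ ^ (2 * aexp d) := by ring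
    _ ≤ D.small r := S5_le_small h

omit [DecidableEq d] in
/-- `σ⁻¹μ^a ≤ 𝔰`. [folklore] -/
theorem dom_EC : (D.σ : ℝ)⁻¹ * D.μ ^ aexp d ≤ D.small r := by
  have h1 : D.μ ^ aexp d ≤ D.μ ^ (2 * aexp d) := Real.rpow_le_rpow_of_exponent_le h.hμ (by linarith [aexp_nonneg h])
  exact (mul_le_mul_of_nonneg_left h1 (by positivity)).trans (S5_le_small h)

omit [DecidableEq d] in
/-- `ν⁻² ≤ 𝔰`. [folklore] -/
theorem dom_νν : D.ν⁻¹ ^ 2 ≤ D.small r := by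
  have hν : D.ν⁻¹ ≤ 1 := inv_le_one_of_one_le₀ h.hν
  have hν0 : 0 ≤ D.ν⁻¹ := inv_nonneg.2 (by linarith [h.hν])
  calc D.ν⁻¹ ^ 2 = D.ν⁻¹ * D.ν⁻¹ := sq _
    _ ≤ D.ν⁻¹ * 1 := mul_le_mul_of_nonneg_left hν hν0
    _ = D.ν⁻¹ := mul_one _
    _ ≤ D.small r := S1_le_small h

end Small


/-! ## Time integration of profile slice bounds -/

section Profile

variable {D : Datum d} (h : D.Valid) {A : ℝ} (hA : D.DataBounds A)
include h hA

/-- **From profile slice bounds to `L¹_t`**: if `‖Z(t)‖_{L^p} ≤ ∑_x (P₁|G_x| + P₂|G_x'| + P₃G_x²) + P₄`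
on `(0,T)` with `Pᵢ ≥ 0`, then
`‖Z‖_{L¹(0,T;L^p)} ≤ N (P₁ (T+1)κ^{-1/2}A + P₂ (T+1)νκ^{1/2}A + P₃ (T+1)) + P₄ T`. [cite: CheskidovLuo2022, §4.2 (4.10)–(4.12)] -/
theorem eLqLpNorm_one_le_of_profile {E : Type*} [NormedAddCommGroup E] {Z : ℝ → UnitAddTorus d → E} {p : ℝ≥0∞}
    {P₁ P₂ P₃ P₄ : ℝ} (h1 : 0 ≤ P₁) (h2 : 0 ≤ P₂) (h3 : 0 ≤ P₃) (h4 : 0 ≤ P₄)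
    (hle : ∀ t ∈ Ioo 0 D.T, eLpNorm (Z t) p volume ≤
      ENNReal.ofReal (∑ x, (P₁ * |D.G x t| + P₂ * |D.dG x t| + P₃ * D.G x t ^ 2) + P₄)) :
    eLqLpNorm 1 p Z (Ioo 0 D.T) ≤ ENNReal.ofReal (Fintype.card (Index d) *
      (P₁ * ((D.T + 1) * D.κ ^ (-(1 / 2 : ℝ)) * A) + P₂ * ((D.T + 1) * D.ν * D.κ ^ (1 / 2 : ℝ) * A) + P₃ * (D.T + 1)) +
        P₄ * D.T) := by
  have hT := h.hT.le
  have hGc : ∀ x, Continuous (D.G x) := fun x => (contDiff_G h x).continuous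
  have hdGc : ∀ x, Continuous (D.dG x) := fun x => (contDiff_dG h x).continuous
  have hφterm : ∀ x, Continuous fun t => P₁ * |D.G x t| + P₂ * |D.dG x t| + P₃ * D.G x t ^ 2 := fun x =>
    ((continuous_const.mul (hGc x).abs).add (continuous_const.mul (hdGc x).abs)).add (continuous_const.mul ((hGc x).pow 2))
  have hsumc : Continuous fun t => ∑ x, (P₁ * |D.G x t| + P₂ * |D.dG x t| + P₃ * D.G x t ^ 2) :=
    continuous_finsetSum _ fun x _ => hφterm x
  have hφc : Continuous fun t => ∑ x, (P₁ * |D.G x t| + P₂ * |D.dG x t| + P₃ * D.G x t ^ 2) + P₄ := hsumc.add continuous_const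
  have hφ0 : ∀ t ∈ Ioo 0 D.T, 0 ≤ ∑ x, (P₁ * |D.G x t| + P₂ * |D.dG x t| + P₃ * D.G x t ^ 2) + P₄ := fun t _ =>
    add_nonneg (Finset.sum_nonneg fun x _ => by positivity) h4
  refine (Torus.eLqLpNorm_one_le_ofReal_integral_of_slice_le hT hφc.continuousOn hφ0 hle).trans (ENNReal.ofReal_le_ofReal ?_)
  -- compute the time integral
  have iG : ∀ x, IntervalIntegrable (fun t => P₁ * |D.G x t|) volume 0 D.T := fun x => (continuous_const.mul (hGc x).abs).intervalIntegrable _ _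
  have idG : ∀ x, IntervalIntegrable (fun t => P₂ * |D.dG x t|) volume 0 D.T := fun x => (continuous_const.mul (hdGc x).abs).intervalIntegrable _ _
  have iG2 : ∀ x, IntervalIntegrable (fun t => P₃ * D.G x t ^ 2) volume 0 D.T := fun x => (continuous_const.mul ((hGc x).pow 2)).intervalIntegrable _ _
  have e1 : ∫ t in (0 : ℝ)..D.T, (∑ x, (P₁ * |D.G x t| + P₂ * |D.dG x t| + P₃ * D.G x t ^ 2) + P₄) =
      ∑ x, ((P₁ * ∫ t in (0 : ℝ)..D.T, |D.G x t|) + (P₂ * ∫ t in (0 : ℝ)..D.T, |D.dG x t|) +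
        P₃ * ∫ t in (0 : ℝ)..D.T, D.G x t ^ 2) + P₄ * D.T := by
    rw [intervalIntegral.integral_add (hsumc.intervalIntegrable _ _) intervalIntegrable_const, intervalIntegral.integral_const,
      smul_eq_mul, sub_zero, mul_comm D.T, intervalIntegral.integral_finsetSum fun x _ => ((iG x).add (idG x)).add (iG2 x)]
    congr 1
    refine Finset.sum_congr rfl fun x _ => ?_
    rw [intervalIntegral.integral_add ((iG x).add (idG x)) (iG2 x), intervalIntegral.integral_add (iG x) (idG x),
      intervalIntegral.integral_const_mul, intervalIntegral.integral_const_mul, intervalIntegral.integral_const_mul]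
  rw [e1]
  have hb : ∀ x, (P₁ * ∫ t in (0 : ℝ)..D.T, |D.G x t|) + (P₂ * ∫ t in (0 : ℝ)..D.T, |D.dG x t|) + P₃ * ∫ t in (0 : ℝ)..D.T, D.G x t ^ 2 ≤
      P₁ * ((D.T + 1) * D.κ ^ (-(1 / 2 : ℝ)) * A) + P₂ * ((D.T + 1) * D.ν * D.κ ^ (1 / 2 : ℝ) * A) + P₃ * (D.T + 1) := by
    intro x
    exact add_le_add (add_le_add (mul_le_mul_of_nonneg_left (intervalIntegral_abs_G_le h hA x) h1)
      (mul_le_mul_of_nonneg_left (intervalIntegral_abs_dG_le h hA x) h2)) (mul_le_mul_of_nonneg_left (intervalIntegral_G_sq_le h x) h3)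
  calc (∑ x, ((P₁ * ∫ t in (0 : ℝ)..D.T, |D.G x t|) + (P₂ * ∫ t in (0 : ℝ)..D.T, |D.dG x t|) + P₃ * ∫ t in (0 : ℝ)..D.T, D.G x t ^ 2)) + P₄ * D.T
      ≤ (∑ _x : Index d, (P₁ * ((D.T + 1) * D.κ ^ (-(1 / 2 : ℝ)) * A) + P₂ * ((D.T + 1) * D.ν * D.κ ^ (1 / 2 : ℝ) * A) + P₃ * (D.T + 1))) +
          P₄ * D.T := add_le_add (Finset.sum_le_sum fun x _ => hb x) le_rfl
    _ = _ := by rw [Finset.sum_const, Finset.card_univ, nsmul_eq_mul]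

omit hA in
/-- **One direction at a time, squared**: `(∑_x |G_x(t)|)² = ∑_x G_x(t)²`. [folklore] -/
theorem sum_abs_G_sq (t : ℝ) : (∑ x, |D.G x t|) ^ 2 = ∑ x, D.G x t ^ 2 := by
  rw [sq, Finset.sum_mul_sum]
  refine Finset.sum_congr rfl fun x _ => ?_
  rw [Finset.sum_eq_single x (fun x' _ hx' => abs_G_mul_abs_G h (Ne.symm hx') t) (fun hx => (hx (Finset.mem_univ x)).elim)]
  rw [abs_mul_abs_self, sq]

end Profile

/-! ## The slice bound of the new stress -/

section Slice

variable {D : Datum d} (h : D.Valid) {A C : ℝ} (hA : D.DataBounds A) (hC : D.BlockConsts C)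
  {u : ℝ → UnitAddTorus d → EuclideanSpace ℝ d} {U : ℝ} (hU0 : 0 ≤ U) (hU : ∀ t ∈ Icc 0 D.T, ∀ y, ‖u t y‖ ≤ U)
  {r : ℝ} (hr : 1 ≤ r) (hr2 : r ≤ 2)

include h hA hC in
/-- **Slice bound of `S₁`**: with `S = ∑_x|G_x(t)|`, `S' = ∑_x|G_x'(t)|`, `S₂ = ∑_x G_x(t)²`,
`α = 3ACμ^a`, `β = 6AdCσ⁻¹μ^{a-1}`, `V_t = Nν⁻¹A`:
`‖S₁(t)‖_{L^r} ≤ (2αβ + β²)S₂ + (2α + 2β)V_t S + V_t² + K_A S' + K_B S' + K_C S₂`. [cite: CheskidovLuo2022, §5.3 Lemmas 5.6–5.8] -/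
theorem eLpNorm_S₁_le (hr : 1 ≤ r) (hr2 : r ≤ 2) {t : ℝ} (ht : t ∈ Icc 0 D.T) :
    eLpNorm (D.S₁ t) (ENNReal.ofReal r) volume ≤ ENNReal.ofReal
      ((2 * (3 * A * C * D.μ ^ aexp d) * (6 * A * (Fintype.card d * (C * (D.σ : ℝ)⁻¹ * D.μ ^ (aexp d - 1)))) +
          (6 * A * (Fintype.card d * (C * (D.σ : ℝ)⁻¹ * D.μ ^ (aexp d - 1)))) ^ 2) * (∑ x, D.G x t ^ 2) +
        (2 * (3 * A * C * D.μ ^ aexp d) + 2 * (6 * A * (Fintype.card d * (C * (D.σ : ℝ)⁻¹ * D.μ ^ (aexp d - 1))))) *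
          (Fintype.card (Index d) * D.ν⁻¹ * A) * (∑ x, |D.G x t|) +
        (Fintype.card (Index d) * D.ν⁻¹ * A) ^ 2 +
        (6 * A * (Fintype.card d * (C * (D.σ : ℝ)⁻¹ * D.μ ^ (aexp d - 1 - ((Fintype.card d : ℝ) - 1) / r)))) * (∑ x, |D.dG x t|) +
        (4 * A * Fintype.card d * (Fintype.card d * (C * ((D.σ : ℝ) ^ 2)⁻¹ * D.μ ^ (aexp d - 2 - ((Fintype.card d : ℝ) - 1) / r)))) *
          (∑ x, |D.dG x t|) +
        (6 * A * (Fintype.card d * (C * (D.σ : ℝ)⁻¹ * D.μ ^ aexp d))) * (∑ x, D.G x t ^ 2)) := by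
  have hr1 : (1 : ℝ≥0∞) ≤ ENNReal.ofReal r := by rw [← ENNReal.ofReal_one]; exact ENNReal.ofReal_le_ofReal hr
  have hμ0 : 0 ≤ D.μ := zero_le_one.trans h.hμ
  have hA0 := hA.nonneg
  have hC0 := hC.nonneg
  have hν0 : 0 ≤ D.ν⁻¹ := inv_nonneg.2 (zero_le_one.trans h.hν)
  set α : ℝ := 3 * A * C * D.μ ^ aexp d with hα
  set β : ℝ := 6 * A * (Fintype.card d * (C * (D.σ : ℝ)⁻¹ * D.μ ^ (aexp d - 1))) with hβ
  set Vt : ℝ := Fintype.card (Index d) * D.ν⁻¹ * A with hVt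
  set S : ℝ := ∑ x, |D.G x t| with hS
  set S₂ : ℝ := ∑ x, D.G x t ^ 2 with hS₂
  set Sd : ℝ := ∑ x, |D.dG x t| with hSd
  have hα0 : 0 ≤ α := by positivity
  have hβ0 : 0 ≤ β := by positivity
  have hVt0 : 0 ≤ Vt := by positivity
  have hS0 : 0 ≤ S := Finset.sum_nonneg fun _ _ => abs_nonneg _
  -- `Q`
  have hQ : eLpNorm (D.Qten t) (ENNReal.ofReal r) volume ≤ ENNReal.ofReal ((2 * α * β + β ^ 2) * S₂ + (2 * α + 2 * β) * Vt * S + Vt ^ 2) := by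
    refine Torus.eLpNorm_le_of_forall_norm_le (fun y => ?_) _
    have hwp : ‖D.wp t y‖ ≤ α * S := by
      have := norm_wp_le_sum hA hC ht y; rwa [← Finset.mul_sum] at this
    have hv : ‖D.wc t y + D.wt t y‖ ≤ β * S + Vt := by
      refine (norm_add_le _ _).trans (add_le_add ?_ (norm_wt_le h hA ht y))
      have := norm_wc_le_sum h hA hC ht y; rwa [← Finset.mul_sum] at this
    have hv0 : 0 ≤ ‖D.wc t y + D.wt t y‖ := norm_nonneg _
    calc ‖D.Qten t y‖ ≤ 2 * ‖D.wp t y‖ * ‖D.wc t y + D.wt t y‖ + ‖D.wc t y + D.wt t y‖ ^ 2 := norm_Qten_le t y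
      _ ≤ 2 * (α * S) * (β * S + Vt) + (β * S + Vt) ^ 2 := by
          have h1 : 2 * ‖D.wp t y‖ * ‖D.wc t y + D.wt t y‖ ≤ 2 * (α * S) * (β * S + Vt) :=
            mul_le_mul (mul_le_mul_of_nonneg_left hwp (by norm_num)) hv hv0 (by positivity)
          have h2 : ‖D.wc t y + D.wt t y‖ ^ 2 ≤ (β * S + Vt) ^ 2 := pow_le_pow_left₀ hv0 hv 2
          linarith
      _ = (2 * α * β + β ^ 2) * S₂ + (2 * α + 2 * β) * Vt * S + Vt ^ 2 := by
          rw [hS₂, ← sum_abs_G_sq h t]; ring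
  -- the decomposition
  have e : D.S₁ t = D.Qten t + D.EA t + D.EB t + D.EC t := by rw [S₁_eq]; rfl
  have mQ := (isSmooth_Qten h ht).continuous.aestronglyMeasurable (μ := volume)
  have mA := (isSmooth_EA h ht).continuous.aestronglyMeasurable (μ := volume)
  have mB := (isSmooth_EB h ht).continuous.aestronglyMeasurable (μ := volume)
  have mC := (isSmooth_EC h ht).continuous.aestronglyMeasurable (μ := volume)
  have hEA := eLpNorm_EA_le h hA hC ht hr hr2
  have hEB := eLpNorm_EB_le h hA hC ht hr hr2
  have hEC := eLpNorm_EC_le h hA hC ht hr2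
  rw [← Finset.mul_sum] at hEA hEB hEC
  rw [← hSd] at hEA hEB
  rw [← hS₂] at hEC
  rw [e]
  calc eLpNorm (D.Qten t + D.EA t + D.EB t + D.EC t) (ENNReal.ofReal r) volume
      ≤ eLpNorm (D.Qten t) (ENNReal.ofReal r) volume + eLpNorm (D.EA t) (ENNReal.ofReal r) volume +
          eLpNorm (D.EB t) (ENNReal.ofReal r) volume + eLpNorm (D.EC t) (ENNReal.ofReal r) volume := by
        refine (eLpNorm_add_le ((mQ.add mA).add mB) mC hr1).trans (add_le_add ?_ le_rfl)
        refine (eLpNorm_add_le (mQ.add mA) mB hr1).trans (add_le_add ?_ le_rfl)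
        exact eLpNorm_add_le mQ mA hr1
    _ ≤ _ := by
        refine (add_le_add (add_le_add (add_le_add hQ hEA) hEB) hEC).trans (le_of_eq ?_)
        rw [← ENNReal.ofReal_add (by positivity) (by positivity), ← ENNReal.ofReal_add (by positivity) (by positivity),
          ← ENNReal.ofReal_add (by positivity) (by positivity)]

include h hA hC in
/-- **Slice bound of `w`**: `‖w(t)‖_{L^r} ≤ (3ACμ^{a-(d-1)/r} + 6AdCσ⁻¹μ^{a-1-(d-1)/r}) S + V_t`. [cite: CheskidovLuo2022, §5.3 Lemma 5.6] -/
theorem eLpNorm_w_le (hr : 1 ≤ r) (hr2 : r ≤ 2) {t : ℝ} (ht : t ∈ Icc 0 D.T) :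
    eLpNorm (D.w t) (ENNReal.ofReal r) volume ≤ ENNReal.ofReal
      ((3 * A * C * D.μ ^ (aexp d - ((Fintype.card d : ℝ) - 1) / r) +
          6 * A * (Fintype.card d * (C * (D.σ : ℝ)⁻¹ * D.μ ^ (aexp d - 1 - ((Fintype.card d : ℝ) - 1) / r)))) * (∑ x, |D.G x t|) +
        Fintype.card (Index d) * D.ν⁻¹ * A) := by
  have hr1 : (1 : ℝ≥0∞) ≤ ENNReal.ofReal r := by rw [← ENNReal.ofReal_one]; exact ENNReal.ofReal_le_ofReal hr
  have hμ0 : 0 ≤ D.μ := zero_le_one.trans h.hμ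
  have hA0 := hA.nonneg; have hC0 := hC.nonneg
  have hν0 : 0 ≤ D.ν⁻¹ := inv_nonneg.2 (zero_le_one.trans h.hν)
  have hS0 : 0 ≤ ∑ x, |D.G x t| := Finset.sum_nonneg fun _ _ => abs_nonneg _
  have e : D.w t = D.wp t + D.wc t + D.wt t := rfl
  have m1 := ((smooth_wp h).isSmooth_slice ht).continuous.aestronglyMeasurable (μ := volume)
  have m2 := ((smooth_wc h).isSmooth_slice ht).continuous.aestronglyMeasurable (μ := volume)
  have m3 := ((smooth_wt h).isSmooth_slice ht).continuous.aestronglyMeasurable (μ := volume)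
  have h1 := eLpNorm_wp_le h hA hC ht hr hr2
  have h2 := eLpNorm_wc_le h hA hC ht hr hr2
  have h3 : eLpNorm (D.wt t) (ENNReal.ofReal r) volume ≤ ENNReal.ofReal (Fintype.card (Index d) * D.ν⁻¹ * A) :=
    Torus.eLpNorm_le_of_forall_norm_le (norm_wt_le h hA ht) _
  rw [← Finset.mul_sum] at h1 h2
  rw [e]
  calc eLpNorm (D.wp t + D.wc t + D.wt t) (ENNReal.ofReal r) volume
      ≤ eLpNorm (D.wp t) (ENNReal.ofReal r) volume + eLpNorm (D.wc t) (ENNReal.ofReal r) volume + eLpNorm (D.wt t) (ENNReal.ofReal r) volume :=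
        (eLpNorm_add_le (m1.add m2) m3 hr1).trans (add_le_add (eLpNorm_add_le m1 m2 hr1) le_rfl)
    _ ≤ _ := by
        refine (add_le_add (add_le_add h1 h2) h3).trans (le_of_eq ?_)
        rw [← ENNReal.ofReal_add (by positivity) (by positivity), ← ENNReal.ofReal_add (by positivity) (by positivity)]
        congr 1; ring

include h hA hC in
/-- **Slice bound of `∂ᵢw`**: `‖∂ᵢw(t)‖_{L^r} ≤ (6ACσμ^{a+1-(d-1)/r} + 12AdCμ^{a-(d-1)/r}) S + V_t`. [cite: CheskidovLuo2022, §5.3 Lemma 5.6] -/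
theorem eLpNorm_partialDeriv_w_le (hr : 1 ≤ r) (hr2 : r ≤ 2) {t : ℝ} (ht : t ∈ Icc 0 D.T) (i : d) :
    eLpNorm (Torus.partialDeriv i (D.w t)) (ENNReal.ofReal r) volume ≤ ENNReal.ofReal
      ((6 * A * C * D.σ * D.μ ^ (aexp d + 1 - ((Fintype.card d : ℝ) - 1) / r) +
          12 * A * Fintype.card d * (C * D.μ ^ (aexp d - ((Fintype.card d : ℝ) - 1) / r))) * (∑ x, |D.G x t|) +
        Fintype.card (Index d) * D.ν⁻¹ * A) := by
  have hr1 : (1 : ℝ≥0∞) ≤ ENNReal.ofReal r := by rw [← ENNReal.ofReal_one]; exact ENNReal.ofReal_le_ofReal hr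
  have hμ0 : 0 ≤ D.μ := zero_le_one.trans h.hμ
  have hA0 := hA.nonneg; have hC0 := hC.nonneg
  have hν0 : 0 ≤ D.ν⁻¹ := inv_nonneg.2 (zero_le_one.trans h.hν)
  have hS0 : 0 ≤ ∑ x, |D.G x t| := Finset.sum_nonneg fun _ _ => abs_nonneg _
  have c1 : Torus.IsContDiff 1 (D.wp t) := ((smooth_wp h).isSmooth_slice ht).isContDiff (by simp)
  have c2 : Torus.IsContDiff 1 (D.wc t) := ((smooth_wc h).isSmooth_slice ht).isContDiff (by simp)
  have c3 : Torus.IsContDiff 1 (D.wt t) := ((smooth_wt h).isSmooth_slice ht).isContDiff (by simp)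
  have e : Torus.partialDeriv i (D.w t) = Torus.partialDeriv i (D.wp t) + Torus.partialDeriv i (D.wc t) + Torus.partialDeriv i (D.wt t) := by
    have e0 : D.w t = D.wp t + D.wc t + D.wt t := rfl
    rw [e0, Torus.partialDeriv_add (c1.add c2) c3, Torus.partialDeriv_add c1 c2]
  have m1 := (((smooth_wp h).isSmooth_slice ht).partialDeriv i).continuous.aestronglyMeasurable (μ := volume)
  have m2 := (((smooth_wc h).isSmooth_slice ht).partialDeriv i).continuous.aestronglyMeasurable (μ := volume)
  have m3 := (((smooth_wt h).isSmooth_slice ht).partialDeriv i).continuous.aestronglyMeasurable (μ := volume)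
  have h1 := eLpNorm_partialDeriv_wp_le h hA hC ht i hr hr2
  have h2 := eLpNorm_partialDeriv_wc_le h hA hC ht i hr hr2
  have h3 : eLpNorm (Torus.partialDeriv i (D.wt t)) (ENNReal.ofReal r) volume ≤ ENNReal.ofReal (Fintype.card (Index d) * D.ν⁻¹ * A) :=
    Torus.eLpNorm_le_of_forall_norm_le (norm_partialDeriv_wt_le h hA ht i) _
  rw [← Finset.mul_sum] at h1 h2
  rw [e]
  calc eLpNorm (Torus.partialDeriv i (D.wp t) + Torus.partialDeriv i (D.wc t) + Torus.partialDeriv i (D.wt t)) (ENNReal.ofReal r) volume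
      ≤ eLpNorm (Torus.partialDeriv i (D.wp t)) (ENNReal.ofReal r) volume + eLpNorm (Torus.partialDeriv i (D.wc t)) (ENNReal.ofReal r) volume +
          eLpNorm (Torus.partialDeriv i (D.wt t)) (ENNReal.ofReal r) volume :=
        (eLpNorm_add_le (m1.add m2) m3 hr1).trans (add_le_add (eLpNorm_add_le m1 m2 hr1) le_rfl)
    _ ≤ _ := by
        refine (add_le_add (add_le_add h1 h2) h3).trans (le_of_eq ?_)
        rw [← ENNReal.ofReal_add (by positivity) (by positivity), ← ENNReal.ofReal_add (by positivity) (by positivity)]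
        congr 1; ring

include h hA hC in
/-- **Slice bound of `ff` in `L²`**:
`‖ff(t)‖₂ ≤ (3AC + 6AdCσ⁻¹μ⁻¹) S + Nν⁻¹(A + 2A²) + 2(2d+1)Ad²Cσ⁻²μ⁻² S' + 3(2d+1)AdCσ⁻¹μ^a S₂`. [cite: CheskidovLuo2022, §5.3 Lemmas 5.6–5.8] -/
theorem eLpNorm_ff_le {t : ℝ} (ht : t ∈ Icc 0 D.T) :
    eLpNorm (D.ff t) 2 volume ≤ ENNReal.ofReal
      ((3 * A * C + 6 * A * (Fintype.card d * (C * (D.σ : ℝ)⁻¹ * D.μ ^ (-1 : ℝ)))) * (∑ x, |D.G x t|) +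
        Fintype.card (Index d) * (D.ν⁻¹ * (A + 2 * A ^ 2)) +
        ((2 * Fintype.card d + 1) * (2 * A) * Fintype.card d * (Fintype.card d * (C * ((D.σ : ℝ) ^ 2)⁻¹ * D.μ ^ (-2 : ℝ)))) *
          (∑ x, |D.dG x t|) +
        ((2 * Fintype.card d + 1) * (3 * A) * (Fintype.card d * (C * (D.σ : ℝ)⁻¹ * D.μ ^ aexp d))) * (∑ x, D.G x t ^ 2)) := by
  have hμ0 : 0 ≤ D.μ := zero_le_one.trans h.hμ
  have hA0 := hA.nonneg; have hC0 := hC.nonneg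
  have hν0 : 0 ≤ D.ν⁻¹ := inv_nonneg.2 (zero_le_one.trans h.hν)
  have hS0 : 0 ≤ ∑ x, |D.G x t| := Finset.sum_nonneg fun _ _ => abs_nonneg _
  have hSd0 : 0 ≤ ∑ x, |D.dG x t| := Finset.sum_nonneg fun _ _ => abs_nonneg _
  have hS20 : 0 ≤ ∑ x, D.G x t ^ 2 := Finset.sum_nonneg fun _ _ => sq_nonneg _
  have e : D.ff t = D.F1 t + D.F2 t - D.F3 t - D.F4B t - D.F4C t := by rw [ff_eq]; rfl
  have m1 := (continuous_F1 h ht).aestronglyMeasurable (μ := volume)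
  have m2 := (continuous_F2 h ht).aestronglyMeasurable (μ := volume)
  have m3 := (continuous_F3 h ht).aestronglyMeasurable (μ := volume)
  have m4 := (continuous_F4B h ht).aestronglyMeasurable (μ := volume)
  have m5 := (continuous_F4C h ht).aestronglyMeasurable (μ := volume)
  have h1 := eLpNorm_F1_le h hA hC ht
  have h2 := eLpNorm_F2_le h hA hC ht
  have h3 := eLpNorm_F3_le h hA ht (2 : ℝ≥0∞)
  have h4 := eLpNorm_F4B_le h hA hC ht
  have h5 := eLpNorm_F4C_le h hA hC ht
  rw [← Finset.mul_sum] at h1 h2 h4 h5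
  rw [e]
  calc eLpNorm (D.F1 t + D.F2 t - D.F3 t - D.F4B t - D.F4C t) 2 volume
      ≤ eLpNorm (D.F1 t) 2 volume + eLpNorm (D.F2 t) 2 volume + eLpNorm (D.F3 t) 2 volume + eLpNorm (D.F4B t) 2 volume +
          eLpNorm (D.F4C t) 2 volume := by
        refine (eLpNorm_sub_le (((m1.add m2).sub m3).sub m4) m5 one_le_two).trans (add_le_add ?_ le_rfl)
        refine (eLpNorm_sub_le ((m1.add m2).sub m3) m4 one_le_two).trans (add_le_add ?_ le_rfl)
        refine (eLpNorm_sub_le (m1.add m2) m3 one_le_two).trans (add_le_add ?_ le_rfl)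
        exact eLpNorm_add_le m1 m2 one_le_two
    _ ≤ _ := by
        refine (add_le_add (add_le_add (add_le_add (add_le_add h1 h2) h3) h4) h5).trans (le_of_eq ?_)
        rw [← ENNReal.ofReal_add (by positivity) (by positivity), ← ENNReal.ofReal_add (by positivity) (by positivity),
          ← ENNReal.ofReal_add (by positivity) (by positivity), ← ENNReal.ofReal_add (by positivity) (by positivity)]
        congr 1; ring
set_option maxHeartbeats 400000 in -- buildfix (bf3-g26): 160k/180k FAIL, 200k PASS at accept time; line-neutral budget line
include h hA hC hU0 hU in
/-- **The slice bound of the new stress** `R₁ = S̊₁ + (u ⊗ w + w ⊗ u)˚ - (∇w + ∇wᵀ) + ℛ ff` in the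
profile form `‖R₁(t)‖_{L^r} ≤ P₁ S + P₂ S' + P₃ S₂ + P₄` on `[0,T]` (`1 ≤ r ≤ 2`; pointwise
`‖R₁‖ ≤ 2‖S₁‖ + 4‖u‖‖w‖ + 2∑ᵢ‖∂ᵢw‖ + ‖ℛff‖`, `ℛ` bounded on `L²`, `L^r ≤ L²`).
[cite: CheskidovLuo2022, §5.3 Lemmas 5.6–5.8] -/
theorem eLpNorm_perturbedStress_le (hr : 1 ≤ r) (hr2 : r ≤ 2) {t : ℝ} (ht : t ∈ Icc 0 D.T) :
    eLpNorm (Torus.perturbedStress u D.w D.S₁ D.ff t) (ENNReal.ofReal r) volume ≤ ENNReal.ofReal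
      ((2 * ((2 * (3 * A * C * D.μ ^ aexp d) + 2 * (6 * A * (Fintype.card d * (C * (D.σ : ℝ)⁻¹ * D.μ ^ (aexp d - 1))))) *
              (Fintype.card (Index d) * D.ν⁻¹ * A)) +
            4 * U * (3 * A * C * D.μ ^ (aexp d - ((Fintype.card d : ℝ) - 1) / r) +
              6 * A * (Fintype.card d * (C * (D.σ : ℝ)⁻¹ * D.μ ^ (aexp d - 1 - ((Fintype.card d : ℝ) - 1) / r)))) +
            2 * Fintype.card d * (6 * A * C * D.σ * D.μ ^ (aexp d + 1 - ((Fintype.card d : ℝ) - 1) / r) +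
              12 * A * Fintype.card d * (C * D.μ ^ (aexp d - ((Fintype.card d : ℝ) - 1) / r))) +
            Torus.antidivergenceL2Const d * (3 * A * C + 6 * A * (Fintype.card d * (C * (D.σ : ℝ)⁻¹ * D.μ ^ (-1 : ℝ))))) *
          (∑ x, |D.G x t|) +
        (2 * (6 * A * (Fintype.card d * (C * (D.σ : ℝ)⁻¹ * D.μ ^ (aexp d - 1 - ((Fintype.card d : ℝ) - 1) / r))) +
              4 * A * Fintype.card d * (Fintype.card d * (C * ((D.σ : ℝ) ^ 2)⁻¹ * D.μ ^ (aexp d - 2 - ((Fintype.card d : ℝ) - 1) / r)))) +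
            Torus.antidivergenceL2Const d * ((2 * Fintype.card d + 1) * (2 * A) * Fintype.card d *
              (Fintype.card d * (C * ((D.σ : ℝ) ^ 2)⁻¹ * D.μ ^ (-2 : ℝ))))) *
          (∑ x, |D.dG x t|) +
        (2 * (2 * (3 * A * C * D.μ ^ aexp d) * (6 * A * (Fintype.card d * (C * (D.σ : ℝ)⁻¹ * D.μ ^ (aexp d - 1)))) +
                (6 * A * (Fintype.card d * (C * (D.σ : ℝ)⁻¹ * D.μ ^ (aexp d - 1)))) ^ 2) +
            2 * (6 * A * (Fintype.card d * (C * (D.σ : ℝ)⁻¹ * D.μ ^ aexp d))) +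
            Torus.antidivergenceL2Const d * ((2 * Fintype.card d + 1) * (3 * A) * (Fintype.card d * (C * (D.σ : ℝ)⁻¹ * D.μ ^ aexp d)))) *
          (∑ x, D.G x t ^ 2) +
        (2 * (Fintype.card (Index d) * D.ν⁻¹ * A) ^ 2 + 4 * U * (Fintype.card (Index d) * D.ν⁻¹ * A) +
            2 * Fintype.card d * (Fintype.card (Index d) * D.ν⁻¹ * A) +
            Torus.antidivergenceL2Const d * (Fintype.card (Index d) * (D.ν⁻¹ * (A + 2 * A ^ 2))))) := by
  have hr1 : (1 : ℝ≥0∞) ≤ ENNReal.ofReal r := by rw [← ENNReal.ofReal_one]; exact ENNReal.ofReal_le_ofReal hr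
  have hr2' : ENNReal.ofReal r ≤ 2 := by have := ENNReal.ofReal_le_ofReal hr2; rwa [ENNReal.ofReal_ofNat] at this
  have hd := h.hd
  have hμ0 : 0 ≤ D.μ := zero_le_one.trans h.hμ
  have hA0 := hA.nonneg; have hC0 := hC.nonneg
  have hν0 : 0 ≤ D.ν⁻¹ := inv_nonneg.2 (zero_le_one.trans h.hν)
  have hℛ0 : 0 ≤ Torus.antidivergenceL2Const d := Torus.antidivergenceL2Const_nonneg
  set S : ℝ := ∑ x, |D.G x t| with hS
  set S₂ : ℝ := ∑ x, D.G x t ^ 2 with hS₂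
  set Sd : ℝ := ∑ x, |D.dG x t| with hSd
  have hS0 : 0 ≤ S := Finset.sum_nonneg fun _ _ => abs_nonneg _
  have hSd0 : 0 ≤ Sd := Finset.sum_nonneg fun _ _ => abs_nonneg _
  have hS20 : 0 ≤ S₂ := Finset.sum_nonneg fun _ _ => sq_nonneg _
  -- smoothness of the slices
  have hwt : Torus.IsSmooth (D.w t) := (smooth_w h).isSmooth_slice ht
  have hw1 : Torus.IsContDiff 1 (D.w t) := hwt.isContDiff (by simp)
  have hSt : Torus.IsSmooth (D.S₁ t) := (smooth_S₁ h).isSmooth_slice ht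
  have hft : Torus.IsSmooth (D.ff t) := (smooth_ff h).isSmooth_slice ht
  -- the four real majorant fields (`‖u‖ ≤ U` is used pointwise first)
  set g₁ : UnitAddTorus d → ℝ := fun y => 2 * ‖D.S₁ t y‖ with hg₁
  set g₂ : UnitAddTorus d → ℝ := fun y => 4 * U * ‖D.w t y‖ with hg₂
  set g₃ : UnitAddTorus d → ℝ := fun y => 2 * ∑ i, ‖Torus.partialDeriv i (D.w t) y‖ with hg₃
  set g₄ : UnitAddTorus d → ℝ := fun y => ‖Torus.antidivergence (D.ff t) y‖ with hg₄
  have mg₁ : AEStronglyMeasurable g₁ volume := (continuous_const.mul hSt.continuous.norm).aestronglyMeasurable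
  have mg₂ : AEStronglyMeasurable g₂ volume := (continuous_const.mul hwt.continuous.norm).aestronglyMeasurable
  have mg₃ : AEStronglyMeasurable g₃ volume :=
    (continuous_const.mul (continuous_finsetSum _ fun i _ => (hwt.partialDeriv i).continuous.norm)).aestronglyMeasurable
  have mg₄ : AEStronglyMeasurable g₄ volume := (Torus.isSmooth_antidivergence hft).continuous.norm.aestronglyMeasurable
  -- pointwise domination
  have hpt : ∀ y, ‖Torus.perturbedStress u D.w D.S₁ D.ff t y‖ ≤ (g₁ + g₂ + g₃ + g₄) y := by
    intro y
    have h0 := Torus.norm_perturbedStress_le (u := u) (S₁ := D.S₁) (f := D.ff) hw1 y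
    have hu' : 4 * ‖u t y‖ * ‖D.w t y‖ ≤ 4 * U * ‖D.w t y‖ :=
      mul_le_mul_of_nonneg_right (mul_le_mul_of_nonneg_left (hU t ht y) (by norm_num)) (norm_nonneg _)
    simp only [Pi.add_apply, hg₁, hg₂, hg₃, hg₄]
    linarith
  -- the four `L^r` bounds (each through a one-term majorant, to stay inside `ofReal`)
  set X₁ : ℝ := (2 * (3 * A * C * D.μ ^ aexp d) * (6 * A * (Fintype.card d * (C * (D.σ : ℝ)⁻¹ * D.μ ^ (aexp d - 1)))) +
          (6 * A * (Fintype.card d * (C * (D.σ : ℝ)⁻¹ * D.μ ^ (aexp d - 1)))) ^ 2) * S₂ +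
        (2 * (3 * A * C * D.μ ^ aexp d) + 2 * (6 * A * (Fintype.card d * (C * (D.σ : ℝ)⁻¹ * D.μ ^ (aexp d - 1))))) *
          (Fintype.card (Index d) * D.ν⁻¹ * A) * S +
        (Fintype.card (Index d) * D.ν⁻¹ * A) ^ 2 +
        (6 * A * (Fintype.card d * (C * (D.σ : ℝ)⁻¹ * D.μ ^ (aexp d - 1 - ((Fintype.card d : ℝ) - 1) / r)))) * Sd +
        (4 * A * Fintype.card d * (Fintype.card d * (C * ((D.σ : ℝ) ^ 2)⁻¹ * D.μ ^ (aexp d - 2 - ((Fintype.card d : ℝ) - 1) / r)))) * Sd +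
        (6 * A * (Fintype.card d * (C * (D.σ : ℝ)⁻¹ * D.μ ^ aexp d))) * S₂ with hX₁
  set X₂ : ℝ := (3 * A * C * D.μ ^ (aexp d - ((Fintype.card d : ℝ) - 1) / r) +
          6 * A * (Fintype.card d * (C * (D.σ : ℝ)⁻¹ * D.μ ^ (aexp d - 1 - ((Fintype.card d : ℝ) - 1) / r)))) * S +
        Fintype.card (Index d) * D.ν⁻¹ * A with hX₂
  set X₃ : ℝ := (6 * A * C * D.σ * D.μ ^ (aexp d + 1 - ((Fintype.card d : ℝ) - 1) / r) +
          12 * A * Fintype.card d * (C * D.μ ^ (aexp d - ((Fintype.card d : ℝ) - 1) / r))) * S +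
        Fintype.card (Index d) * D.ν⁻¹ * A with hX₃
  set X₄ : ℝ := (3 * A * C + 6 * A * (Fintype.card d * (C * (D.σ : ℝ)⁻¹ * D.μ ^ (-1 : ℝ)))) * S +
        Fintype.card (Index d) * (D.ν⁻¹ * (A + 2 * A ^ 2)) +
        ((2 * Fintype.card d + 1) * (2 * A) * Fintype.card d * (Fintype.card d * (C * ((D.σ : ℝ) ^ 2)⁻¹ * D.μ ^ (-2 : ℝ)))) * Sd +
        ((2 * Fintype.card d + 1) * (3 * A) * (Fintype.card d * (C * (D.σ : ℝ)⁻¹ * D.μ ^ aexp d))) * S₂ with hX₄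
  have hX₁0 : 0 ≤ X₁ := by rw [hX₁]; positivity
  have hX₂0 : 0 ≤ X₂ := by rw [hX₂]; positivity
  have hX₃0 : 0 ≤ X₃ := by rw [hX₃]; positivity
  have hX₄0 : 0 ≤ X₄ := by rw [hX₄]; positivity
  have hS₁ : eLpNorm (D.S₁ t) (ENNReal.ofReal r) volume ≤ ENNReal.ofReal X₁ := by rw [hX₁]; exact eLpNorm_S₁_le h hA hC hr hr2 ht
  have hw : eLpNorm (D.w t) (ENNReal.ofReal r) volume ≤ ENNReal.ofReal X₂ := by rw [hX₂]; exact eLpNorm_w_le h hA hC hr hr2 ht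
  have hdw : ∀ i, eLpNorm (Torus.partialDeriv i (D.w t)) (ENNReal.ofReal r) volume ≤ ENNReal.ofReal X₃ := fun i => by
    rw [hX₃]; exact eLpNorm_partialDeriv_w_le h hA hC hr hr2 ht i
  have hℛff : eLpNorm (Torus.antidivergence (D.ff t)) (ENNReal.ofReal r) volume ≤ ENNReal.ofReal (Torus.antidivergenceL2Const d * X₄) := by
    calc eLpNorm (Torus.antidivergence (D.ff t)) (ENNReal.ofReal r) volume ≤ eLpNorm (Torus.antidivergence (D.ff t)) 2 volume :=
          Torus.eLpNorm_le_eLpNorm_of_le (Torus.isSmooth_antidivergence hft).continuous hr2'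
      _ ≤ ENNReal.ofReal (Torus.antidivergenceL2Const d) * eLpNorm (D.ff t) 2 volume := Torus.eLpNorm_antidivergence_le hd hft
      _ ≤ ENNReal.ofReal (Torus.antidivergenceL2Const d) * ENNReal.ofReal X₄ := by
          refine mul_le_mul' le_rfl ?_; rw [hX₄]; exact eLpNorm_ff_le h hA hC ht
      _ = ENNReal.ofReal (Torus.antidivergenceL2Const d * X₄) := (ENNReal.ofReal_mul hℛ0).symm
  -- one-term majorants for the real fields
  have b₁ : eLpNorm g₁ (ENNReal.ofReal r) volume ≤ ENNReal.ofReal (2 * X₁) := by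
    have h1 := Torus.eLpNorm_le_of_norm_le_sum (E := ℝ) (Finset.univ : Finset Unit) (F := g₁) (c := fun _ => (2 : ℝ)) (K := fun _ => X₁)
      (m := fun _ y => ‖D.S₁ t y‖) (fun _ _ => zero_le_two) (fun _ _ => hX₁0) (fun _ _ => hSt.continuous.norm.aestronglyMeasurable)
      (fun _ _ => by rw [eLpNorm_norm]; exact hS₁) (fun y => ?_) hr1
    · simpa using h1
    · simp [hg₁, abs_of_nonneg (norm_nonneg _)]
  have b₂ : eLpNorm g₂ (ENNReal.ofReal r) volume ≤ ENNReal.ofReal (4 * U * X₂) := by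
    have h1 := Torus.eLpNorm_le_of_norm_le_sum (E := ℝ) (Finset.univ : Finset Unit) (F := g₂) (c := fun _ => 4 * U) (K := fun _ => X₂)
      (m := fun _ y => ‖D.w t y‖) (fun _ _ => mul_nonneg (by norm_num) hU0) (fun _ _ => hX₂0) (fun _ _ => hwt.continuous.norm.aestronglyMeasurable)
      (fun _ _ => by rw [eLpNorm_norm]; exact hw) (fun y => ?_) hr1
    · simpa using h1
    · simp [hg₂, abs_of_nonneg (norm_nonneg _), abs_of_nonneg hU0]
  have b₃ : eLpNorm g₃ (ENNReal.ofReal r) volume ≤ ENNReal.ofReal (Fintype.card d * (2 * X₃)) := by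
    have h1 := Torus.eLpNorm_le_of_norm_le_sum (E := ℝ) Finset.univ (F := g₃) (c := fun _ => (2 : ℝ)) (K := fun _ => X₃)
      (m := fun i y => ‖Torus.partialDeriv i (D.w t) y‖) (fun _ _ => zero_le_two) (fun _ _ => hX₃0)
      (fun i _ => (hwt.partialDeriv i).continuous.norm.aestronglyMeasurable) (fun i _ => by rw [eLpNorm_norm]; exact hdw i) (fun y => ?_) hr1
    · simpa [Finset.sum_const, Finset.card_univ] using h1
    · rw [hg₃]
      simp only [Real.norm_eq_abs, abs_of_nonneg (norm_nonneg _), Finset.mul_sum]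
      rw [abs_of_nonneg (Finset.sum_nonneg fun i _ => by positivity)]
  have b₄ : eLpNorm g₄ (ENNReal.ofReal r) volume ≤ ENNReal.ofReal (Torus.antidivergenceL2Const d * X₄) := by
    rw [hg₄, eLpNorm_norm]; exact hℛff
  -- assemble
  have hsum4 : ENNReal.ofReal (2 * X₁) + ENNReal.ofReal (4 * U * X₂) + ENNReal.ofReal (Fintype.card d * (2 * X₃)) +
      ENNReal.ofReal (Torus.antidivergenceL2Const d * X₄) =
        ENNReal.ofReal (2 * X₁ + 4 * U * X₂ + Fintype.card d * (2 * X₃) + Torus.antidivergenceL2Const d * X₄) := by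
    have n1 : 0 ≤ 2 * X₁ := mul_nonneg zero_le_two hX₁0
    have n2 : 0 ≤ 4 * U * X₂ := mul_nonneg (mul_nonneg (by norm_num) hU0) hX₂0
    have n3 : 0 ≤ Fintype.card d * (2 * X₃) := mul_nonneg (Nat.cast_nonneg _) (mul_nonneg zero_le_two hX₃0)
    have n4 : 0 ≤ Torus.antidivergenceL2Const d * X₄ := mul_nonneg hℛ0 hX₄0
    rw [← ENNReal.ofReal_add n1 n2, ← ENNReal.ofReal_add (add_nonneg n1 n2) n3, ← ENNReal.ofReal_add (add_nonneg (add_nonneg n1 n2) n3) n4]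
  calc eLpNorm (Torus.perturbedStress u D.w D.S₁ D.ff t) (ENNReal.ofReal r) volume
      ≤ eLpNorm (g₁ + g₂ + g₃ + g₄) (ENNReal.ofReal r) volume := eLpNorm_mono_real hpt
    _ ≤ eLpNorm g₁ (ENNReal.ofReal r) volume + eLpNorm g₂ (ENNReal.ofReal r) volume + eLpNorm g₃ (ENNReal.ofReal r) volume +
          eLpNorm g₄ (ENNReal.ofReal r) volume := by
        refine (eLpNorm_add_le ((mg₁.add mg₂).add mg₃) mg₄ hr1).trans (add_le_add ?_ le_rfl)
        refine (eLpNorm_add_le (mg₁.add mg₂) mg₃ hr1).trans (add_le_add ?_ le_rfl)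
        exact eLpNorm_add_le mg₁ mg₂ hr1
    _ ≤ _ := add_le_add (add_le_add (add_le_add b₁ b₂) b₃) b₄
    _ = _ := hsum4
    _ = _ := by
        congr 1
        rw [hX₁, hX₂, hX₃, hX₄]
        ring

end Slice

/-! ## The `L¹_t L^r_x` estimate -/

section Main

variable {D : Datum d} (h : D.Valid) {A C : ℝ} (hA : D.DataBounds A) (hC : D.BlockConsts C)
  {u : ℝ → UnitAddTorus d → EuclideanSpace ℝ d} {U : ℝ} (hU0 : 0 ≤ U) (hU : ∀ t ∈ Icc 0 D.T, ∀ y, ‖u t y‖ ≤ U)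
  {r : ℝ}

include h hA hC hU0 hU in
/-- **The stress estimate (CL22 §5.3, Lemmas 5.6–5.8, quantitative form).** For the new Reynolds
stress `R₁ = S̊₁ + (u ⊗ w + w ⊗ u)˚ - (∇w + ∇wᵀ) + ℛ ff` of the perturbed triple
(`Torus.IsNSReynoldsOn.perturb` with `w = D.w`, `S₁ = D.S₁`, `f = D.ff`), any background `u` with
`‖u‖ ≤ U` on `[0,T] × 𝕋^d` and `1 ≤ r ≤ 2`:
`‖R₁‖_{L¹(0,T;L^r)} ≤ stressConst(A, C, U, C_ℛ, T, d, #Λ) · 𝔰(ν, κ, μ, σ; r)`, with `𝔰 = D.small r`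
the sum of the six small monomials and a constant independent of `ν, κ, μ, σ` ("for all sufficiently
large `λ`, each part of the stress is less than `δ/4`"). [cite: CheskidovLuo2022, §5.3 Lemmas 5.6–5.8] -/
theorem eLqLpNorm_one_perturbedStress_le (hr : 1 ≤ r) (hr2 : r ≤ 2) :
    eLqLpNorm 1 (ENNReal.ofReal r) (Torus.perturbedStress u D.w D.S₁ D.ff) (Ioo 0 D.T) ≤
      ENNReal.ofReal (stressConst A C U (Torus.antidivergenceL2Const d) D.T (Fintype.card d) (Fintype.card (Index d)) * D.small r) := by
  have hd := h.hd
  have hμ0 : 0 ≤ D.μ := zero_le_one.trans h.hμ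
  have hν0' : 0 ≤ D.ν := zero_le_one.trans h.hν
  have hκ0 : 0 ≤ D.κ := zero_le_one.trans h.hκ
  have hA0 := hA.nonneg; have hC0 := hC.nonneg
  have hν0 : 0 ≤ D.ν⁻¹ := inv_nonneg.2 hν0'
  have hℛ0 : 0 ≤ Torus.antidivergenceL2Const d := Torus.antidivergenceL2Const_nonneg
  have hT0 : 0 ≤ D.T := h.hT.le
  have hsm : 0 ≤ D.small r := small_nonneg h
  -- the profile coefficients
  set P₁ : ℝ := 2 * ((2 * (3 * A * C * D.μ ^ aexp d) + 2 * (6 * A * (Fintype.card d * (C * (D.σ : ℝ)⁻¹ * D.μ ^ (aexp d - 1))))) *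
              (Fintype.card (Index d) * D.ν⁻¹ * A)) +
            4 * U * (3 * A * C * D.μ ^ (aexp d - ((Fintype.card d : ℝ) - 1) / r) +
              6 * A * (Fintype.card d * (C * (D.σ : ℝ)⁻¹ * D.μ ^ (aexp d - 1 - ((Fintype.card d : ℝ) - 1) / r)))) +
            2 * Fintype.card d * (6 * A * C * D.σ * D.μ ^ (aexp d + 1 - ((Fintype.card d : ℝ) - 1) / r) +
              12 * A * Fintype.card d * (C * D.μ ^ (aexp d - ((Fintype.card d : ℝ) - 1) / r))) +
            Torus.antidivergenceL2Const d * (3 * A * C + 6 * A * (Fintype.card d * (C * (D.σ : ℝ)⁻¹ * D.μ ^ (-1 : ℝ)))) with hP₁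
  set P₂ : ℝ := 2 * (6 * A * (Fintype.card d * (C * (D.σ : ℝ)⁻¹ * D.μ ^ (aexp d - 1 - ((Fintype.card d : ℝ) - 1) / r))) +
              4 * A * Fintype.card d * (Fintype.card d * (C * ((D.σ : ℝ) ^ 2)⁻¹ * D.μ ^ (aexp d - 2 - ((Fintype.card d : ℝ) - 1) / r)))) +
            Torus.antidivergenceL2Const d * ((2 * Fintype.card d + 1) * (2 * A) * Fintype.card d *
              (Fintype.card d * (C * ((D.σ : ℝ) ^ 2)⁻¹ * D.μ ^ (-2 : ℝ)))) with hP₂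
  set P₃ : ℝ := 2 * (2 * (3 * A * C * D.μ ^ aexp d) * (6 * A * (Fintype.card d * (C * (D.σ : ℝ)⁻¹ * D.μ ^ (aexp d - 1)))) +
                (6 * A * (Fintype.card d * (C * (D.σ : ℝ)⁻¹ * D.μ ^ (aexp d - 1)))) ^ 2) +
            2 * (6 * A * (Fintype.card d * (C * (D.σ : ℝ)⁻¹ * D.μ ^ aexp d))) +
            Torus.antidivergenceL2Const d * ((2 * Fintype.card d + 1) * (3 * A) * (Fintype.card d * (C * (D.σ : ℝ)⁻¹ * D.μ ^ aexp d))) with hP₃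
  set P₄ : ℝ := 2 * (Fintype.card (Index d) * D.ν⁻¹ * A) ^ 2 + 4 * U * (Fintype.card (Index d) * D.ν⁻¹ * A) +
            2 * Fintype.card d * (Fintype.card (Index d) * D.ν⁻¹ * A) +
            Torus.antidivergenceL2Const d * (Fintype.card (Index d) * (D.ν⁻¹ * (A + 2 * A ^ 2))) with hP₄
  have hP₁0 : 0 ≤ P₁ := by rw [hP₁]; positivity
  have hP₂0 : 0 ≤ P₂ := by rw [hP₂]; positivity
  have hP₃0 : 0 ≤ P₃ := by rw [hP₃]; positivity
  have hP₄0 : 0 ≤ P₄ := by rw [hP₄]; positivity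
  -- slice bounds in profile form
  have hle : ∀ t ∈ Ioo 0 D.T, eLpNorm (Torus.perturbedStress u D.w D.S₁ D.ff t) (ENNReal.ofReal r) volume ≤
      ENNReal.ofReal (∑ x, (P₁ * |D.G x t| + P₂ * |D.dG x t| + P₃ * D.G x t ^ 2) + P₄) := by
    intro t ht
    refine (eLpNorm_perturbedStress_le h hA hC hU0 hU hr hr2 (Ioo_subset_Icc_self ht)).trans (le_of_eq ?_)
    congr 1
    rw [Finset.sum_add_distrib, Finset.sum_add_distrib, ← Finset.mul_sum, ← Finset.mul_sum, ← Finset.mul_sum]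
  refine (eLqLpNorm_one_le_of_profile h hA hP₁0 hP₂0 hP₃0 hP₄0 hle).trans (ENNReal.ofReal_le_ofReal ?_)
  -- domination of the four groups
  have NN : 0 ≤ (Fintype.card (Index d) : ℝ) := Nat.cast_nonneg _
  have DD : 0 ≤ (Fintype.card d : ℝ) := Nat.cast_nonneg _
  have d1 := dom_cross h (r := r)
  have d2 := dom_cross' h (r := r)
  have d3 := dom_wp h hr
  have d4 := dom_wc h hr
  have d5 := dom_dwp h (r := r)
  have d6 := dom_F1 h (r := r)
  have d7 := dom_F2 h (r := r)
  have d9 := dom_EA h (r := r)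
  have d10 := dom_EB h (r := r)
  have d11 := dom_F4B h (r := r)
  have d12 := dom_αβ h (r := r)
  have d13 := dom_ββ h (r := r)
  have d14 := dom_EC h (r := r)
  have d16 := dom_νν h (r := r)
  have d17 := S1_le_small h (r := r)
  -- group 1
  have G1 : P₁ * D.κ ^ (-(1 / 2 : ℝ)) ≤
      (2 * (2 * (3 * A * C)) * (Fintype.card (Index d) * A)) * D.small r +
        (2 * (2 * (6 * A * (Fintype.card d * C))) * (Fintype.card (Index d) * A)) * D.small r +
        (4 * U * (3 * A * C)) * D.small r + (4 * U * (6 * A * (Fintype.card d * C))) * D.small r +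
        (2 * Fintype.card d * (6 * A * C)) * D.small r + (2 * Fintype.card d * (12 * A * Fintype.card d * C)) * D.small r +
        (Torus.antidivergenceL2Const d * (3 * A * C)) * D.small r +
        (Torus.antidivergenceL2Const d * (6 * A * (Fintype.card d * C))) * D.small r := by
    have e : P₁ * D.κ ^ (-(1 / 2 : ℝ)) =
        (2 * (2 * (3 * A * C)) * (Fintype.card (Index d) * A)) * (D.μ ^ aexp d * D.ν⁻¹ * D.κ ^ (-(1 / 2 : ℝ))) +
        (2 * (2 * (6 * A * (Fintype.card d * C))) * (Fintype.card (Index d) * A)) * ((D.σ : ℝ)⁻¹ * D.μ ^ (aexp d - 1) * D.ν⁻¹ * D.κ ^ (-(1 / 2 : ℝ))) +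
        (4 * U * (3 * A * C)) * (D.μ ^ (aexp d - ((Fintype.card d : ℝ) - 1) / r) * D.κ ^ (-(1 / 2 : ℝ))) +
        (4 * U * (6 * A * (Fintype.card d * C))) * ((D.σ : ℝ)⁻¹ * D.μ ^ (aexp d - 1 - ((Fintype.card d : ℝ) - 1) / r) * D.κ ^ (-(1 / 2 : ℝ))) +
        (2 * Fintype.card d * (6 * A * C)) * (D.σ * D.μ ^ (aexp d + 1 - ((Fintype.card d : ℝ) - 1) / r) * D.κ ^ (-(1 / 2 : ℝ))) +
        (2 * Fintype.card d * (12 * A * Fintype.card d * C)) * (D.μ ^ (aexp d - ((Fintype.card d : ℝ) - 1) / r) * D.κ ^ (-(1 / 2 : ℝ))) +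
        (Torus.antidivergenceL2Const d * (3 * A * C)) * D.κ ^ (-(1 / 2 : ℝ)) +
        (Torus.antidivergenceL2Const d * (6 * A * (Fintype.card d * C))) * ((D.σ : ℝ)⁻¹ * D.μ ^ (-1 : ℝ) * D.κ ^ (-(1 / 2 : ℝ))) := by
      rw [hP₁]; ring
    rw [e]
    have s1 := mul_le_mul_of_nonneg_left d1 (by positivity : (0 : ℝ) ≤ 2 * (2 * (3 * A * C)) * (Fintype.card (Index d) * A))
    have s2 := mul_le_mul_of_nonneg_left d2 (by positivity : (0 : ℝ) ≤ 2 * (2 * (6 * A * (Fintype.card d * C))) * (Fintype.card (Index d) * A))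
    have s3 := mul_le_mul_of_nonneg_left d3 (by positivity : (0 : ℝ) ≤ 4 * U * (3 * A * C))
    have s4 := mul_le_mul_of_nonneg_left d4 (by positivity : (0 : ℝ) ≤ 4 * U * (6 * A * (Fintype.card d * C)))
    have s5 := mul_le_mul_of_nonneg_left d5 (by positivity : (0 : ℝ) ≤ 2 * Fintype.card d * (6 * A * C))
    have s6 := mul_le_mul_of_nonneg_left d3 (by positivity : (0 : ℝ) ≤ 2 * Fintype.card d * (12 * A * Fintype.card d * C))
    have s7 := mul_le_mul_of_nonneg_left d6 (by positivity : (0 : ℝ) ≤ Torus.antidivergenceL2Const d * (3 * A * C))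
    have s8 := mul_le_mul_of_nonneg_left d7 (by positivity : (0 : ℝ) ≤ Torus.antidivergenceL2Const d * (6 * A * (Fintype.card d * C)))
    exact add_le_add (add_le_add (add_le_add (add_le_add (add_le_add (add_le_add (add_le_add s1 s2) s3) s4) s5) s6) s7) s8
  -- group 2
  have G2 : P₂ * (D.ν * D.κ ^ (1 / 2 : ℝ)) ≤
      (2 * (6 * A * (Fintype.card d * C))) * D.small r + (2 * (4 * A * Fintype.card d * (Fintype.card d * C))) * D.small r +
        (Torus.antidivergenceL2Const d * ((2 * Fintype.card d + 1) * (2 * A) * Fintype.card d * (Fintype.card d * C))) * D.small r := by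
    have e : P₂ * (D.ν * D.κ ^ (1 / 2 : ℝ)) =
        (2 * (6 * A * (Fintype.card d * C))) * ((D.σ : ℝ)⁻¹ * D.μ ^ (aexp d - 1 - ((Fintype.card d : ℝ) - 1) / r) * (D.ν * D.κ ^ (1 / 2 : ℝ))) +
        (2 * (4 * A * Fintype.card d * (Fintype.card d * C))) * (((D.σ : ℝ) ^ 2)⁻¹ * D.μ ^ (aexp d - 2 - ((Fintype.card d : ℝ) - 1) / r) * (D.ν * D.κ ^ (1 / 2 : ℝ))) +
        (Torus.antidivergenceL2Const d * ((2 * Fintype.card d + 1) * (2 * A) * Fintype.card d * (Fintype.card d * C))) *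
          (((D.σ : ℝ) ^ 2)⁻¹ * D.μ ^ (-2 : ℝ) * (D.ν * D.κ ^ (1 / 2 : ℝ))) := by
      rw [hP₂]; ring
    rw [e]
    have s1 := mul_le_mul_of_nonneg_left d9 (by positivity : (0 : ℝ) ≤ 2 * (6 * A * (Fintype.card d * C)))
    have s2 := mul_le_mul_of_nonneg_left d10 (by positivity : (0 : ℝ) ≤ 2 * (4 * A * Fintype.card d * (Fintype.card d * C)))
    have s3 := mul_le_mul_of_nonneg_left d11
      (by positivity : (0 : ℝ) ≤ Torus.antidivergenceL2Const d * ((2 * Fintype.card d + 1) * (2 * A) * Fintype.card d * (Fintype.card d * C)))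
    exact add_le_add (add_le_add s1 s2) s3
  -- group 3
  have G3 : P₃ ≤
      (2 * (2 * (3 * A * C) * (6 * A * (Fintype.card d * C)))) * D.small r + (2 * (6 * A * (Fintype.card d * C)) ^ 2) * D.small r +
        (2 * (6 * A * (Fintype.card d * C))) * D.small r +
        (Torus.antidivergenceL2Const d * ((2 * Fintype.card d + 1) * (3 * A) * (Fintype.card d * C))) * D.small r := by
    have e : P₃ =
        (2 * (2 * (3 * A * C) * (6 * A * (Fintype.card d * C)))) * (D.μ ^ aexp d * ((D.σ : ℝ)⁻¹ * D.μ ^ (aexp d - 1))) +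
        (2 * (6 * A * (Fintype.card d * C)) ^ 2) * ((D.σ : ℝ)⁻¹ * D.μ ^ (aexp d - 1)) ^ 2 +
        (2 * (6 * A * (Fintype.card d * C))) * ((D.σ : ℝ)⁻¹ * D.μ ^ aexp d) +
        (Torus.antidivergenceL2Const d * ((2 * Fintype.card d + 1) * (3 * A) * (Fintype.card d * C))) * ((D.σ : ℝ)⁻¹ * D.μ ^ aexp d) := by
      rw [hP₃]; ring
    rw [e]
    have s1 := mul_le_mul_of_nonneg_left d12 (by positivity : (0 : ℝ) ≤ 2 * (2 * (3 * A * C) * (6 * A * (Fintype.card d * C))))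
    have s2 := mul_le_mul_of_nonneg_left d13 (by positivity : (0 : ℝ) ≤ 2 * (6 * A * (Fintype.card d * C)) ^ 2)
    have s3 := mul_le_mul_of_nonneg_left d14 (by positivity : (0 : ℝ) ≤ 2 * (6 * A * (Fintype.card d * C)))
    have s4 := mul_le_mul_of_nonneg_left d14
      (by positivity : (0 : ℝ) ≤ Torus.antidivergenceL2Const d * ((2 * Fintype.card d + 1) * (3 * A) * (Fintype.card d * C)))
    exact add_le_add (add_le_add (add_le_add s1 s2) s3) s4
  -- group 4
  have G4 : P₄ ≤
      (2 * (Fintype.card (Index d) * A) ^ 2) * D.small r + (4 * U * (Fintype.card (Index d) * A)) * D.small r +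
        (2 * Fintype.card d * (Fintype.card (Index d) * A)) * D.small r +
        (Torus.antidivergenceL2Const d * (Fintype.card (Index d) * (A + 2 * A ^ 2))) * D.small r := by
    have e : P₄ = (2 * (Fintype.card (Index d) * A) ^ 2) * D.ν⁻¹ ^ 2 + (4 * U * (Fintype.card (Index d) * A)) * D.ν⁻¹ +
        (2 * Fintype.card d * (Fintype.card (Index d) * A)) * D.ν⁻¹ + (Torus.antidivergenceL2Const d * (Fintype.card (Index d) * (A + 2 * A ^ 2))) * D.ν⁻¹ := by
      rw [hP₄]; ring
    rw [e]
    have s1 := mul_le_mul_of_nonneg_left d16 (by positivity : (0 : ℝ) ≤ 2 * (Fintype.card (Index d) * A) ^ 2)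
    have s2 := mul_le_mul_of_nonneg_left d17 (by positivity : (0 : ℝ) ≤ 4 * U * (Fintype.card (Index d) * A))
    have s3 := mul_le_mul_of_nonneg_left d17 (by positivity : (0 : ℝ) ≤ 2 * Fintype.card d * (Fintype.card (Index d) * A))
    have s4 := mul_le_mul_of_nonneg_left d17 (by positivity : (0 : ℝ) ≤ Torus.antidivergenceL2Const d * (Fintype.card (Index d) * (A + 2 * A ^ 2)))
    exact add_le_add (add_le_add (add_le_add s1 s2) s3) s4
  -- put together
  have hTA : 0 ≤ (D.T + 1) * A := by positivity
  have hT1 : 0 ≤ D.T + 1 := by positivity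
  have t1 := mul_le_mul_of_nonneg_left G1 (mul_nonneg NN hTA)
  have t2 := mul_le_mul_of_nonneg_left G2 (mul_nonneg NN hTA)
  have t3 := mul_le_mul_of_nonneg_left G3 (mul_nonneg NN hT1)
  have t4 := mul_le_mul_of_nonneg_left G4 hT0
  have e : Fintype.card (Index d) *
        (P₁ * ((D.T + 1) * D.κ ^ (-(1 / 2 : ℝ)) * A) + P₂ * ((D.T + 1) * D.ν * D.κ ^ (1 / 2 : ℝ) * A) + P₃ * (D.T + 1)) + P₄ * D.T =
      Fintype.card (Index d) * ((D.T + 1) * A) * (P₁ * D.κ ^ (-(1 / 2 : ℝ))) + Fintype.card (Index d) * ((D.T + 1) * A) * (P₂ * (D.ν * D.κ ^ (1 / 2 : ℝ))) +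
        Fintype.card (Index d) * (D.T + 1) * P₃ + D.T * P₄ := by ring
  rw [e]
  refine (add_le_add (add_le_add (add_le_add t1 t2) t3) t4).trans (le_of_eq ?_)
  unfold stressConst
  ring

end Main


end Datum

end CL22

end Literature.Analysis.FluidPDE
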